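import Literature.MathematicalPhysics.QuantumFieldTheory.Balaban1983to89.Node00.Record13PartCompatOfSize
import Literature.MathematicalPhysics.QuantumFieldTheory.Balaban1983to89.Node00.Record13NumericsOfThm1CCMW
import Literature.MathematicalPhysics.QuantumFieldTheory.Balaban1983to89.B15Claim189N0OfRecord

/-!
# DAG node N11 — THE RUN GUARD `PartCompat₁₃` OF THE NO-EXPANSION 𝐓-STEP FROM THE RUN's COUPLINGS: at a power-of-`L` basic cube `M = L^a` the per-level divisibility
# `L^i·M·R_i ∣ 2·L^{m+K}` IS the scalar `(log g_i⁻²)^r ≤ L^{m+K−i−a}` (EXACT, both directions); at K1's witness of record θ₁₅ᶜᶜᴹᵂ(j; γ) (`a = j`, `r = 1`) the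
# binding instance is the LAST level — a windowed run of full length `K` is compatible only if `j + 1 ≤ m` (LOCATED volume floor, count-neutral)

HEADER — WORK-UNIT METADATA.  Cell `pub-ymgap`, YM-PLAN Track A (HUMAN RULING D-0062 ∕ D-0149 width seats), seat `pub-ymgap-dag-n11-w4` (g3; WIDTH SEAT 4 of 4 on
NODE n11 [B14]), route `BalabanUVNodes`, item K1⁷ `StabilityBAtRecordR13SepCoPH` = stmt-QuantumFields-20542 (helper, `--kind proof --supports 20542 --as helper`, count-neutral).
[III] = [Balaban1988Convergent], [I] = [Balaban1987RG1].  Over node00-def-K0a's `Node00/Record13PartCompatOfSize` (FILE 13f: ★ `Stage13Params.partCompat₁₃_of_dCubeSide_le` ∕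
`dCubeSide_le_of_partCompat₁₃` — (C2) ⟺ SIZE of the `𝐃_j`-cubes at `M = L^a`; `le_of_pow_le_two_mul_pow`), dag-n20∕K0c's `B15Claim189N0OfRecord` (`RkOfRecord_le_pow_of_le`: any power of
`L` above `(log g⁻²)^r` is above `R(g)`), def-R's `isRj_RkOfRecord` ((2.5): `R(g) = L^s ≥ (log g⁻²)^r`, `s` least), dag-n21-c's `Node00/Record13NumericsOfThm1CCMW` (K1's witness of record
`θ₁₅ᶜᶜᴹᵂ(j; γ)`: `M = L^j`, `r = 1`, both `rfl`).

WHY THIS FILE.  After this seat's `…N11CubeCoverRowOfNesting` (p606678: `hcov` ⟸ `PartCompat₁₃` ∧ `L·M₂ ∣ M`) and dag-n11-w3 g3's `…N11NoExpansionNumerics` (the five numeric rows ⟸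
seven scalars), the per-level rows still DISPLAYED by the no-expansion 𝐓-step faces in the ZhPin class are K0's solvability `hsolv` and the structural RUN GUARD `hPC : PartCompat₁₃ θ p n`
= «for `1 ≤ i ≤ n` the `𝐃_i`-cube side `L^i·M·R_i(g_i)` divides the torus period `2·L^{m+K}`» ([III] p. 257 «partitions … compatible»; also the antecedent of def-T's record row `bg`).
K0a's 13f turned it into the SIZE bound `L^i·M·R_i ≤ 2·L^{m+K}` at `M = L^a` and warned that «a window premise alone does NOT give it (a run with `g₀ → 0` has `R_1 → ∞`)».  THIS
FILE finishes the reduction to the run's LETTERS: `R_i = R(g_i)` is the least power of `L` above `(log g_i⁻²)^r` ((2.5)), so `R_i ≤ L^c ⟺ (log g_i⁻²)^r ≤ L^c`, and for the odd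
`L ≥ 13` of the record `L^{i+a+s} ≤ 2·L^{m+K} ⟺ i + a + s ≤ m + K`; hence, EXACTLY, `PartCompat₁₃ θ p n ⟺ ∀ 1 ≤ i ≤ n, (log g_i⁻²)^r ≤ L^{m+K−i−a}` (given the room
`n + a ≤ m + K`, itself necessary for `n ≥ 1`).  The log-log growth of the left side along an asymptotically free run is dominated by the `L^{K−i}` room at every level but the
LAST: at `n = K` the row reads `(log g_K⁻²)^r ≤ L^{m−a}` — the physical volume exponent against the collar exponent and the renormalised coupling.  At K1's witness of record
`θ₁₅ᶜᶜᴹᵂ(j; γ)` (`a = j`, `r = 1`) a run in ANY window `]0, γ′]` with `γ′ < e^{−1∕2}` has `log g_i⁻² > 1` at every level, so compatibility up to `n` FORCES the strict room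
`n + j + 1 ≤ m + K`; at full length `n = K`: `j + 1 ≤ F.m`.  LOCATED (count-neutral, nothing refuted): for a family with `F.m = 1` no `j ≥ 1` admits a compatible full-length windowed
run at θ₁₅ᶜᶜᴹᵂ, while `j = 0` (`M = 1`) fails the cube cover (`L ∤ 1`, p606678) — whether K1's `∀ F` carries a volume floor is the plan's ∕ def-T's word (c2, director-ym №145 (F1)).

WHAT THIS FILE PROVES (0 `sorry`, 0 `def`; nothing of Bałaban asserted).  §1 arithmetic on (2.5): `dCubeSide_le_of_log_pow_le` · `room_of_dCubeSide_le` · `log_pow_le_of_dCubeSide_le` ·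
`one_lt_log_inv_sq_of_lt` (`0 < g ≤ γ′ < e^{−1∕2} ⇒ 1 < log g⁻²`).  §2 generic `θ` with `θ.τ9.M = F.L^a`: `sitesPerDir_zero_eq` · ★★ `partCompat₁₃_of_log_pow_le` (per-level exponents
`c i`) · ★★ `log_pow_le_of_partCompat₁₃` (converse: room + scalar at every level) · ★★★ `partCompat₁₃_iff_log_pow_le` · `not_partCompat₁₃_of_room_lt`.  §3 at K1's witness of record
θ₁₅ᶜᶜᴹᵂ(j; γ): ★★ `partCompat₁₃_theta13OfThm1CCMW_iff` (`∀ 1 ≤ i ≤ n, log g_i⁻² ≤ L^{m+K−i−j}`, given `n + j ≤ m + K`) · ★ `room_lt_of_partCompat₁₃_theta13OfThm1CCMW_of_window`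
(LOCATED: a compatible run in a window `γ′ < e^{−1∕2}` up to `n ≥ 1` has `n + j + 1 ≤ F.m + p.K`) · `not_partCompat₁₃_theta13OfThm1CCMW_top_of_window` (`F.m ≤ j` ⇒ no compatible
full-length windowed run).

HONEST FRAMING.  Helper lane of K1⁷; elementary ℕ∕ℝ bookkeeping on the record's definitions; nothing of [III]'s estimates asserted; no law of record edited or posited; NOT a discharge
and NOT a refutation of any registered text (the LOCATED lemmas constrain which `(F, j, run)` can feed the displayed row `hPC`, they do not deny K1⁷).  N11 NOT discharged; K1⁷ NOT
closed; counts unmoved (typed 28∕28 · discharged 5∕27).  R4 closes only the conditional finite-𝕋⁴ rung `BalabanLadder.UV` of one programme at fixed `ε = L^{−K}` — NOT ℝ⁴, NOT OS,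
NOT a mass gap, NOT Clay.  No `sorry`, `axiom`, `def`, `instance`, `notation`.  Sources (SHAPE only): [III] (2.1) p.254, (2.5) p.255, (2.17)–(2.18) p.257; [I] (0.1) p.251 (the
torus `2L^m∕ε`), p.245 («M = L^m»).
-/

noncomputable section

namespace Summit.QuantumFields.YangMills.Theorems.BalabanUVNodesN11PartCompatOfCouplings

open Literature.MathematicalPhysics.QuantumFieldTheory.Balaban1983to89 T4Continuum Node00
open B15Claim189N0OfRecord (RkOfRecord_le_pow_of_le)

/-! ## §1  Arithmetic on (2.5): the `𝐃_i`-cube side against the torus period, through the coupling -/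

section Arith

/-- **SIZE FROM THE COUPLING**: at `M = L^a`, if `(log g⁻²)^r ≤ L^c` and `i + a + c ≤ m + K` then the `𝐃_i`-cube side `L^i·M·R(g)` is at most the torus period `2·L^{m+K}`
(`R(g) ≤ L^c` by minimality in (2.5)). [cite: Balaban1988Convergent, (2.1) p.254, (2.5) p.255, p.257] -/
theorem dCubeSide_le_of_log_pow_le {L M a r i c m K : ℕ} (hL : 2 ≤ L) (hM : M = L ^ a) (g : ℝ)
    (hlog : (Real.log (g ^ 2)⁻¹) ^ r ≤ ((L ^ c : ℕ) : ℝ)) (hc : i + a + c ≤ m + K) :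
    dCubeSide L M (RkOfRecord L r g) i ≤ 2 * L ^ (m + K) := by
  have hR : RkOfRecord L r g ≤ L ^ c := RkOfRecord_le_pow_of_le hL r g hlog
  unfold dCubeSide
  calc L ^ i * M * RkOfRecord L r g ≤ L ^ i * M * L ^ c := Nat.mul_le_mul_left _ hR
    _ = L ^ (i + a + c) := by rw [hM, ← pow_add, ← pow_add]
    _ ≤ L ^ (m + K) := Nat.pow_le_pow_right (by omega) hc
    _ ≤ 2 * L ^ (m + K) := Nat.le_mul_of_pos_left _ (by norm_num)

/-- **ROOM**: at `M = L^a` (`L ≥ 3`), if the `𝐃_i`-cube fits the torus then `i + a ≤ m + K` (since `R(g) = L^s`, `L^{i+a+s} ≤ 2·L^{m+K}` forces `i + a + s ≤ m + K`).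
[cite: Balaban1988Convergent, (2.1) p.254, (2.5) p.255, p.257] -/
theorem room_of_dCubeSide_le {L M a r i m K : ℕ} (hL : 3 ≤ L) (hM : M = L ^ a) (g : ℝ)
    (h : dCubeSide L M (RkOfRecord L r g) i ≤ 2 * L ^ (m + K)) : i + a ≤ m + K := by
  obtain ⟨s, hs, -, -⟩ := isRj_RkOfRecord (by omega : 2 ≤ L) r g
  have h' : L ^ (i + a + s) ≤ 2 * L ^ (m + K) := by
    have hside : dCubeSide L M (RkOfRecord L r g) i = L ^ (i + a + s) := by rw [dCubeSide, hM, hs, pow_add, pow_add]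
    rw [← hside]; exact h
  have := le_of_pow_le_two_mul_pow hL h'
  omega

/-- **THE COUPLING FROM THE SIZE** (converse of `dCubeSide_le_of_log_pow_le` at `M = L^a`, `L ≥ 3`): if the `𝐃_i`-cube fits the torus then `(log g⁻²)^r ≤ L^{m+K−i−a}`
(`(log g⁻²)^r ≤ R(g) = L^s` and `i + a + s ≤ m + K`). [cite: Balaban1988Convergent, (2.1) p.254, (2.5) p.255, p.257] -/
theorem log_pow_le_of_dCubeSide_le {L M a r i m K : ℕ} (hL : 3 ≤ L) (hM : M = L ^ a) (g : ℝ)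
    (h : dCubeSide L M (RkOfRecord L r g) i ≤ 2 * L ^ (m + K)) :
    (Real.log (g ^ 2)⁻¹) ^ r ≤ ((L ^ (m + K - i - a) : ℕ) : ℝ) := by
  obtain ⟨s, hs, hle, -⟩ := isRj_RkOfRecord (by omega : 2 ≤ L) r g
  have h' : L ^ (i + a + s) ≤ 2 * L ^ (m + K) := by
    have hside : dCubeSide L M (RkOfRecord L r g) i = L ^ (i + a + s) := by rw [dCubeSide, hM, hs, pow_add, pow_add]
    rw [← hside]; exact h
  have hs' : i + a + s ≤ m + K := le_of_pow_le_two_mul_pow hL h'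
  calc (Real.log (g ^ 2)⁻¹) ^ r ≤ (RkOfRecord L r g : ℝ) := hle
    _ = ((L ^ s : ℕ) : ℝ) := by rw [hs]
    _ ≤ ((L ^ (m + K - i - a) : ℕ) : ℝ) := by exact_mod_cast Nat.pow_le_pow_right (by omega) (by omega)

/-- **IN A WINDOW BELOW `e^{−1∕2}` THE LOGARITHM EXCEEDS ONE**: `0 < g ≤ γ′ < e^{−1∕2} ⇒ 1 < log g⁻²` (so `R(g) ≥ L` for `r ≥ 1`). [cite: Balaban1988Convergent, (2.5) p.255 (bookkeeping)] -/
theorem one_lt_log_inv_sq_of_lt {g γ' : ℝ} (hg : 0 < g) (hgγ : g ≤ γ') (hγ : γ' < Real.exp (-(1 / 2))) : 1 < Real.log (g ^ 2)⁻¹ := by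
  have hglt : g < Real.exp (-(1 / 2)) := lt_of_le_of_lt hgγ hγ
  have hg2 : g ^ 2 < Real.exp (-1) := by
    have h1 : g ^ 2 < Real.exp (-(1 / 2)) ^ 2 := by gcongr
    have h2 : Real.exp (-(1 / 2)) ^ 2 = Real.exp (-1) := by rw [← Real.exp_nat_mul]; norm_num
    rwa [h2] at h1
  have hpos : 0 < g ^ 2 := by positivity
  rw [Real.log_inv, lt_neg, ← Real.exp_lt_exp, Real.exp_log hpos]
  exact hg2

end Arith

/-! ## §2  `PartCompat₁₃` at a power-of-`L` basic cube IS the per-level scalar `(log g_i⁻²)^r ≤ L^{m+K−i−a}` on the run's couplings -/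

section Generic

variable {F : T4Family} {N : ℕ} [NeZero N]

/-- The torus period of the `K`-th approximation: `2·L^{m+K}` fine sites per direction. [cite: Balaban1987RG1, (0.1) p.251 (bookkeeping)] -/
theorem sitesPerDir_zero_eq (p : B12.RunParams) : (F.P p.K).sitesPerDir 0 = 2 * F.L ^ (F.m + p.K) := by
  simp [Params.sitesPerDir]

/-- **★★ (C2) FROM THE RUN's COUPLINGS** at `θ.τ9.M = F.L^a`: per-level exponents `c i` with `i + a + c i ≤ m + K` and `(log g_i⁻²)^r ≤ L^{c i}` (`1 ≤ i ≤ n`, `g_i` the run's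
couplings of record) give `PartCompat₁₃ θ p n`. [cite: Balaban1988Convergent, (2.1) p.254, (2.5) p.255, p.257; Balaban1987RG1, (0.1) p.251] -/
theorem partCompat₁₃_of_log_pow_le (θ : Stage13Params F N) {a : ℕ} (hM : θ.τ9.M = F.L ^ a) (p : B12.RunParams) (n : ℕ) (c : ℕ → ℕ)
    (hc : ∀ i, 1 ≤ i → i ≤ n → i + a + c i ≤ F.m + p.K)
    (hlog : ∀ i, 1 ≤ i → i ≤ n → (Real.log (gOfRecord₁₃ F N θ p i ^ 2)⁻¹) ^ θ.ν.r ≤ ((F.L ^ c i : ℕ) : ℝ)) :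
    PartCompat₁₃ F N θ p n := by
  refine θ.partCompat₁₃_of_dCubeSide_le ⟨a, hM⟩ p n fun i h1 hi => ?_
  rw [sitesPerDir_zero_eq]
  simp only [T4Family.P_L]
  exact dCubeSide_le_of_log_pow_le (by have := F.hL11; omega) hM _ (hlog i h1 hi) (hc i h1 hi)

/-- **★★ THE CONVERSE**: at `θ.τ9.M = F.L^a`, a partition-compatible run has, at every level `1 ≤ i ≤ n`, the room `i + a ≤ m + K` and the scalar `(log g_i⁻²)^r ≤ L^{m+K−i−a}`.
[cite: Balaban1988Convergent, (2.1) p.254, (2.5) p.255, p.257; Balaban1987RG1, (0.1) p.251] -/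
theorem log_pow_le_of_partCompat₁₃ (θ : Stage13Params F N) {a : ℕ} (hM : θ.τ9.M = F.L ^ a) (p : B12.RunParams) {n : ℕ}
    (h : PartCompat₁₃ F N θ p n) {i : ℕ} (h1 : 1 ≤ i) (hi : i ≤ n) :
    i + a ≤ F.m + p.K ∧ (Real.log (gOfRecord₁₃ F N θ p i ^ 2)⁻¹) ^ θ.ν.r ≤ ((F.L ^ (F.m + p.K - i - a) : ℕ) : ℝ) := by
  have hsz := θ.dCubeSide_le_of_partCompat₁₃ p n h i h1 hi
  rw [sitesPerDir_zero_eq] at hsz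
  simp only [T4Family.P_L] at hsz
  have hL3 : 3 ≤ F.L := by have := F.hL11; omega
  exact ⟨room_of_dCubeSide_le hL3 hM _ hsz, log_pow_le_of_dCubeSide_le hL3 hM _ hsz⟩

/-- **★★★ `PartCompat₁₃` ⟺ THE PER-LEVEL SCALAR ON THE COUPLINGS** (at `θ.τ9.M = F.L^a`, given the room `n + a ≤ m + K`): the run guard of the no-expansion 𝐓-step faces
(and of def-T's record row `bg`) is EXACTLY `∀ 1 ≤ i ≤ n, (log g_i⁻²)^r ≤ L^{m+K−i−a}`. [cite: Balaban1988Convergent, (2.1) p.254, (2.5) p.255, p.257; Balaban1987RG1, (0.1) p.251] -/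
theorem partCompat₁₃_iff_log_pow_le (θ : Stage13Params F N) {a : ℕ} (hM : θ.τ9.M = F.L ^ a) (p : B12.RunParams) {n : ℕ}
    (hn : n + a ≤ F.m + p.K) :
    PartCompat₁₃ F N θ p n ↔
      ∀ i, 1 ≤ i → i ≤ n → (Real.log (gOfRecord₁₃ F N θ p i ^ 2)⁻¹) ^ θ.ν.r ≤ ((F.L ^ (F.m + p.K - i - a) : ℕ) : ℝ) :=
  ⟨fun h i h1 hi => (log_pow_le_of_partCompat₁₃ θ hM p h h1 hi).2,
    fun h => partCompat₁₃_of_log_pow_le θ hM p n (fun i => F.m + p.K - i - a) (fun i _ hi => by omega) h⟩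

/-- **NO ROOM, NO COMPATIBLE RUN**: at `θ.τ9.M = F.L^a`, if `m + K < n + a` then no run is partition-compatible up to `n ≥ 1` (the level-`n` cube cannot fit).
[cite: Balaban1988Convergent, (2.1) p.254, p.257 (bookkeeping)] -/
theorem not_partCompat₁₃_of_room_lt (θ : Stage13Params F N) {a : ℕ} (hM : θ.τ9.M = F.L ^ a) (p : B12.RunParams) {n : ℕ}
    (hn1 : 1 ≤ n) (hlt : F.m + p.K < n + a) : ¬ PartCompat₁₃ F N θ p n :=
  fun h => absurd (log_pow_le_of_partCompat₁₃ θ hM p h hn1 le_rfl).1 (not_le.mpr hlt)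

end Generic

/-! ## §3  At K1's witness of record `θ₁₅ᶜᶜᴹᵂ(j; γ)` (`M = L^j`, `r = 1`): the scalar, and the LOCATED volume floor for windowed runs -/

section Witness

variable (F : T4Family) (N : ℕ) [NeZero N] (j : ℕ) (γ ε₀ ε₂₉ B₃ B₃' a₀ a₁ : ℝ)

/-- **★★ `PartCompat₁₃` AT θ₁₅ᶜᶜᴹᵂ(j; γ) IS `∀ 1 ≤ i ≤ n, log g_i⁻² ≤ L^{m+K−i−j}`** (given the room `n + j ≤ m + K`): `M = L^j` and `r = 1` are dag-n21-c's `rfl` letters.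
[cite: Balaban1988Convergent, (2.1) p.254, (2.5) p.255, p.257; Balaban1987RG1, (0.1) p.251; Balaban1989LargeFieldI, (2.1) p.182] -/
theorem partCompat₁₃_theta13OfThm1CCMW_iff (p : B12.RunParams) {n : ℕ} (hn : n + j ≤ F.m + p.K) :
    PartCompat₁₃ F N (theta13OfThm1CCMW F N j γ ε₀ ε₂₉ B₃ B₃' a₀ a₁) p n ↔
      ∀ i, 1 ≤ i → i ≤ n →
        Real.log (gOfRecord₁₃ F N (theta13OfThm1CCMW F N j γ ε₀ ε₂₉ B₃ B₃' a₀ a₁) p i ^ 2)⁻¹ ≤ ((F.L ^ (F.m + p.K - i - j) : ℕ) : ℝ) := by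
  rw [partCompat₁₃_iff_log_pow_le (theta13OfThm1CCMW F N j γ ε₀ ε₂₉ B₃ B₃' a₀ a₁) (theta13OfThm1CCMW_τ9_M F N j γ ε₀ ε₂₉ B₃ B₃' a₀ a₁) p hn]
  simp only [theta13OfThm1CCMW_r, pow_one]

/-- **★ LOCATED — THE STRICT ROOM OF A WINDOWED COMPATIBLE RUN AT θ₁₅ᶜᶜᴹᵂ(j; γ)**: if the run's couplings up to level `n ≥ 1` lie in a window `]0, γ′]` with `γ′ < e^{−1∕2}`
(every K1 window: `γ′ ≤ ½ < e^{−1∕2}`), then `log g_n⁻² > 1 = L⁰`, so compatibility up to `n` forces `n + j + 1 ≤ m + K`.  Count-neutral: nothing registered is denied; it says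
which `(F, j, run)` can feed the displayed run guard. [cite: Balaban1988Convergent, (2.1) p.254, (2.5) p.255, p.257; Balaban1987RG1, (0.1) p.251, Thm 1 p.259 (the window)] -/
theorem room_lt_of_partCompat₁₃_theta13OfThm1CCMW_of_window (p : B12.RunParams) {n : ℕ} (hn1 : 1 ≤ n) {γ' : ℝ}
    (hw : Step.InInterval γ' n (gOfRecord₁₃ F N (theta13OfThm1CCMW F N j γ ε₀ ε₂₉ B₃ B₃' a₀ a₁) p)) (hγ : γ' < Real.exp (-(1 / 2)))
    (h : PartCompat₁₃ F N (theta13OfThm1CCMW F N j γ ε₀ ε₂₉ B₃ B₃' a₀ a₁) p n) : n + j + 1 ≤ F.m + p.K := by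
  have hroom := log_pow_le_of_partCompat₁₃ (theta13OfThm1CCMW F N j γ ε₀ ε₂₉ B₃ B₃' a₀ a₁)
    (theta13OfThm1CCMW_τ9_M F N j γ ε₀ ε₂₉ B₃ B₃' a₀ a₁) p h hn1 le_rfl
  simp only [theta13OfThm1CCMW_r, pow_one] at hroom
  obtain ⟨hle, hlog⟩ := hroom
  by_contra hlt
  have h0 : F.m + p.K - n - j = 0 := by omega
  rw [h0, pow_zero, Nat.cast_one] at hlog
  have h1 := one_lt_log_inv_sq_of_lt (hw n le_rfl).1 (hw n le_rfl).2 hγ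
  linarith

/-- **NO COMPATIBLE FULL-LENGTH WINDOWED RUN WHEN `F.m ≤ j`**: at θ₁₅ᶜᶜᴹᵂ(j; γ), a run whose couplings up to the last level `K ≥ 1` lie in a window `γ′ < e^{−1∕2}` is NOT
partition-compatible up to `K` unless `j + 1 ≤ F.m` (the `M·R_K`-cube must fit the unit-lattice torus `2L^m`).  LOCATED, count-neutral (cf. the module docstring: with `F.m = 1`
no `j ≥ 1` survives, and `j = 0` fails the cube cover of p606678). [cite: Balaban1988Convergent, (2.1) p.254, (2.5) p.255, p.257; Balaban1987RG1, (0.1) p.251] -/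
theorem not_partCompat₁₃_theta13OfThm1CCMW_top_of_window (p : B12.RunParams) (hK : 1 ≤ p.K) (hmj : F.m ≤ j) {γ' : ℝ}
    (hw : Step.InInterval γ' p.K (gOfRecord₁₃ F N (theta13OfThm1CCMW F N j γ ε₀ ε₂₉ B₃ B₃' a₀ a₁) p)) (hγ : γ' < Real.exp (-(1 / 2))) :
    ¬ PartCompat₁₃ F N (theta13OfThm1CCMW F N j γ ε₀ ε₂₉ B₃ B₃' a₀ a₁) p p.K := fun h => by
  have := room_lt_of_partCompat₁₃_theta13OfThm1CCMW_of_window F N j γ ε₀ ε₂₉ B₃ B₃' a₀ a₁ p hK hw hγ h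
  omega

end Witness

end Summit.QuantumFields.YangMills.Theorems.BalabanUVNodesN11PartCompatOfCouplings

end
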